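import Summits.AtomisticToContinuum.HydrodynamicLimit.Theorems.CollisionIsometryCLTCollisionalTransferLocalityVelocityAverages
import HarnessLib

/-!
# Second moments of weighted velocity empirical averages under the homogeneous local Gibbs law

Helper file (`--supports stmt-AtomisticToContinuum-9518`, line `hemisphere-affine-slaving`, skeleton
v10.1) for the crux `CollisionalTransferLocality`: the two registered stubs of the equilibrium rung on
WEIGHTED velocity empirical averages `z ↦ (N+1)⁻¹ Σᵢ f(xᵢ) q(vᵢ)` of `N + 1` hard spheres of reduced
diameter `hsDiameter σ N` on `𝕋³` under the homogeneous ("rung 0") local Gibbs law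
`G_N = localGibbsLaw σ (fun _ => a) (fun _ => u) (fun _ => θ) N (Φ N)` (constant activity `a > 0`,
velocity `u`, temperature `θ > 0`, `σ ≤ 1/2`, any flow `Φ N`), for a bounded measurable position
weight `f` (`|f| ≤ C_f`) and a Gaussian-square-integrable velocity mark `q ∈ L²(γ)`,
`γ = gaussMeasure u θ = N(u, θ id)`:

* `integral_wVelAvg_sq_le_localGibbsLaw_const` :
  `∫ ((N+1)⁻¹ Σᵢ f(xᵢ) q(vᵢ))² dG_N ≤ C_f² ∫ q² dγ` (uniformly in `N` and in the flow);
* `memLp_two_wVelAvg_localGibbsLaw_const` : `z ↦ (N+1)⁻¹ Σᵢ f(xᵢ) q(vᵢ) ∈ L²(G_N)`.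

These feed the landed time-integral lemma of the line (the time integrand of the crux's residual at
equilibrium is a finite sum of such weighted averages, with `f` a derivative of the test fields and
`q ∈ {v_j, |v|², v_a v_b, v_a |v|²}`).

Proofs. Pointwise, by the finite Cauchy–Schwarz inequality `sq_velAvg_le_velAvg_sq` and `|f| ≤ C_f`,
`((N+1)⁻¹ Σᵢ f(xᵢ)q(vᵢ))² ≤ (N+1)⁻¹ Σᵢ f(xᵢ)² q(vᵢ)² ≤ C_f² (N+1)⁻¹ Σᵢ q(vᵢ)²`; integrating
(`integral_mono_of_nonneg`, the right side being integrable since each `vᵢ` has law `γ`,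
`measurePreserving_vel_localGibbsLaw_const`) and evaluating the mean of the empirical average of `q²`
(`integral_velAvg_localGibbsLaw_const`, `MemLp.integrable_sq`) gives the first statement. For the
second, each summand `z ↦ f(xᵢ) q(vᵢ)` is a.e.-strongly measurable and dominated in norm by
`C_f |q(vᵢ)| ∈ L²(G_N)` (`MemLp.comp_measurePreserving`, `MemLp.const_mul`, `MemLp.of_le`), and
`L²` is stable under finite sums and scalars (`memLp_finsetSum`, `MemLp.const_mul`). Folklore;
nothing is cited and no dynamics enters.
-/

namespace Summit.AtomisticToContinuum.HydrodynamicLimit.Theorems.HemisphereAffineSlaving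

open scoped BigOperators Topology Classical ENNReal InnerProductSpace
open Filter Set Function MeasureTheory

noncomputable section

open Literature.MathematicalPhysics.KineticTheory (T3 V3)
open Literature.MathematicalPhysics.KineticTheory (gaussMeasure localGibbsLaw)

/-! ### Pointwise bounds -/

/-- A bounded weight times a mark, squared: `(f x · w)² ≤ C_f² · w²` when `|f x| ≤ C_f`.
[folklore] -/
theorem sq_weight_mul_le {f : T3 → ℝ} {Cf : ℝ} (hfC : ∀ x, |f x| ≤ Cf) (x : T3) (w : ℝ) :
    (f x * w) ^ 2 ≤ Cf ^ 2 * w ^ 2 := by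
  rw [mul_pow]
  refine mul_le_mul_of_nonneg_right ?_ (sq_nonneg w)
  calc f x ^ 2 = |f x| ^ 2 := (sq_abs (f x)).symm
    _ ≤ Cf ^ 2 := pow_le_pow_left₀ (abs_nonneg _) (hfC x) 2

/-- Pointwise bound on the square of a weighted velocity empirical average:
`((N+1)⁻¹ Σᵢ f(xᵢ) q(vᵢ))² ≤ C_f² · (N+1)⁻¹ Σᵢ q(vᵢ)²` (finite Cauchy–Schwarz and `|f| ≤ C_f`).
[folklore] -/
theorem sq_wVelAvg_le {N : ℕ} {f : T3 → ℝ} {Cf : ℝ} (hfC : ∀ x, |f x| ≤ Cf) (q : V3 → ℝ)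
    (z : Cfg N) :
    (((N : ℝ) + 1)⁻¹ * ∑ i : Fin (N + 1), f (z i).1 * q (z i).2) ^ 2 ≤
      Cf ^ 2 * (((N : ℝ) + 1)⁻¹ * ∑ i : Fin (N + 1), q (z i).2 ^ 2) := by
  have hn : (0 : ℝ) ≤ ((N : ℝ) + 1)⁻¹ := by positivity
  calc (((N : ℝ) + 1)⁻¹ * ∑ i : Fin (N + 1), f (z i).1 * q (z i).2) ^ 2
      ≤ ((N : ℝ) + 1)⁻¹ * ∑ i : Fin (N + 1), (f (z i).1 * q (z i).2) ^ 2 :=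
        sq_velAvg_le_velAvg_sq fun i => f (z i).1 * q (z i).2
    _ ≤ ((N : ℝ) + 1)⁻¹ * ∑ i : Fin (N + 1), Cf ^ 2 * q (z i).2 ^ 2 :=
        mul_le_mul_of_nonneg_left
          (Finset.sum_le_sum fun i _ => sq_weight_mul_le hfC (z i).1 (q (z i).2)) hn
    _ = Cf ^ 2 * (((N : ℝ) + 1)⁻¹ * ∑ i : Fin (N + 1), q (z i).2 ^ 2) := by
        rw [← Finset.mul_sum]; ring

/-! ### Square integrability of one weighted summand -/

/-- Each weighted summand `z ↦ f(xᵢ) q(vᵢ)` is in `L²(G_N)` under the homogeneous local Gibbs law,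
for `f` bounded measurable and `q ∈ L²(γ)` (dominated by `C_f |q(vᵢ)|`, and `vᵢ` has law `γ`).
[folklore] -/
theorem memLp_two_weight_mul_vel_localGibbsLaw_const {σ a θ : ℝ} (ha : 0 < a) (hθ : 0 < θ)
    (hσ : σ ≤ 1 / 2) (u : V3) (Φ : Flows σ) (N : ℕ) {f : T3 → ℝ} {Cf : ℝ} (hf : Measurable f)
    (hfC : ∀ x, |f x| ≤ Cf) {q : V3 → ℝ} (hq : MemLp q 2 (gaussMeasure u θ)) (i : Fin (N + 1)) :
    MemLp (fun z : Cfg N => f (z i).1 * q (z i).2) 2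
      (localGibbsLaw σ (fun _ => a) (fun _ => u) (fun _ => θ) N (Φ N)) := by
  have hqi : MemLp (fun z : Cfg N => q (z i).2) 2
      (localGibbsLaw σ (fun _ => a) (fun _ => u) (fun _ => θ) N (Φ N)) :=
    hq.comp_measurePreserving (measurePreserving_vel_localGibbsLaw_const ha hθ hσ u Φ N i)
  have hfi : AEStronglyMeasurable (fun z : Cfg N => f (z i).1)
      (localGibbsLaw σ (fun _ => a) (fun _ => u) (fun _ => θ) N (Φ N)) :=
    (hf.comp (measurable_pi_apply i).fst).aestronglyMeasurable
  refine (hqi.const_mul Cf).of_le (hfi.mul hqi.aestronglyMeasurable) (ae_of_all _ fun z => ?_)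
  rw [norm_mul, norm_mul, Real.norm_eq_abs, Real.norm_eq_abs Cf]
  exact mul_le_mul_of_nonneg_right ((hfC _).trans (le_abs_self Cf)) (norm_nonneg _)

/-! ### The two registered stubs -/

/-- **Second moment of a weighted velocity empirical average** under the homogeneous local Gibbs
law: `∫ ((N+1)⁻¹ Σᵢ f(xᵢ) q(vᵢ))² dG_N ≤ C_f² ∫ q² dγ` for `f` measurable with `|f| ≤ C_f` and
`q ∈ L²(γ)`, `γ = N(u, θ id)` (pointwise Cauchy–Schwarz and `|f| ≤ C_f`, then the mean of the
empirical average of `q²`). [folklore] -/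
theorem integral_wVelAvg_sq_le_localGibbsLaw_const : ∀ {σ a θ : ℝ}, 0 < a → 0 < θ → σ ≤ 1 / 2 → ∀ (u : V3) (Φ : Flows σ) (N : ℕ) (f : T3 → ℝ) (Cf : ℝ), Measurable f → (∀ x, |f x| ≤ Cf) → ∀ (q : V3 → ℝ), MemLp q 2 (Literature.MathematicalPhysics.KineticTheory.gaussMeasure u θ) → ∫ z, (((N : ℝ) + 1)⁻¹ * ∑ i : Fin (N + 1), f (z i).1 * q (z i).2) ^ 2 ∂(Literature.MathematicalPhysics.KineticTheory.localGibbsLaw σ (fun _ => a) (fun _ => u) (fun _ => θ) N (Φ N)) ≤ Cf ^ 2 * ∫ v, q v ^ 2 ∂(Literature.MathematicalPhysics.KineticTheory.gaussMeasure u θ) := by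
  intro σ a θ ha hθ hσ u Φ N f Cf _hf hfC q hq
  have h2 : Integrable (fun v => q v ^ 2) (gaussMeasure u θ) := hq.integrable_sq
  have hup : Integrable (fun z : Cfg N => ((N : ℝ) + 1)⁻¹ * ∑ i : Fin (N + 1), q (z i).2 ^ 2)
      (localGibbsLaw σ (fun _ => a) (fun _ => u) (fun _ => θ) N (Φ N)) :=
    (integrable_finsetSum (f := fun (i : Fin (N + 1)) (z : Cfg N) => q (z i).2 ^ 2) _ fun i _ =>
      (measurePreserving_vel_localGibbsLaw_const ha hθ hσ u Φ N i).integrable_comp_of_integrable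
        h2).const_mul _
  calc ∫ z, (((N : ℝ) + 1)⁻¹ * ∑ i : Fin (N + 1), f (z i).1 * q (z i).2) ^ 2
        ∂(localGibbsLaw σ (fun _ => a) (fun _ => u) (fun _ => θ) N (Φ N))
      ≤ ∫ z, Cf ^ 2 * (((N : ℝ) + 1)⁻¹ * ∑ i : Fin (N + 1), q (z i).2 ^ 2)
          ∂(localGibbsLaw σ (fun _ => a) (fun _ => u) (fun _ => θ) N (Φ N)) :=
        integral_mono_of_nonneg (ae_of_all _ fun z => sq_nonneg _) (hup.const_mul _)
          (ae_of_all _ fun z => sq_wVelAvg_le hfC q z)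
    _ = Cf ^ 2 * ∫ v, q v ^ 2 ∂(gaussMeasure u θ) := by
        rw [integral_const_mul,
          integral_velAvg_localGibbsLaw_const ha hθ hσ u Φ N (fun v => q v ^ 2) h2]

/-- **Weighted velocity empirical averages are square integrable** under the homogeneous local
Gibbs law: `z ↦ (N+1)⁻¹ Σᵢ f(xᵢ) q(vᵢ) ∈ L²(G_N)` for `f` measurable with `|f| ≤ C_f` and
`q ∈ L²(γ)` (each summand is dominated by `C_f |q(vᵢ)|`, `vᵢ` having law `γ`). [folklore] -/
theorem memLp_two_wVelAvg_localGibbsLaw_const : ∀ {σ a θ : ℝ}, 0 < a → 0 < θ → σ ≤ 1 / 2 → ∀ (u : V3) (Φ : Flows σ) (N : ℕ) (f : T3 → ℝ) (Cf : ℝ), Measurable f → (∀ x, |f x| ≤ Cf) → ∀ (q : V3 → ℝ), MemLp q 2 (Literature.MathematicalPhysics.KineticTheory.gaussMeasure u θ) → MemLp (fun z : Cfg N => ((N : ℝ) + 1)⁻¹ * ∑ i : Fin (N + 1), f (z i).1 * q (z i).2) 2 (Literature.MathematicalPhysics.KineticTheory.localGibbsLaw σ (fun _ => a) (fun _ =>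 u) (fun _ => θ) N (Φ N)) := by
  intro σ a θ ha hθ hσ u Φ N f Cf hf hfC q hq
  exact (memLp_finsetSum (f := fun (i : Fin (N + 1)) (z : Cfg N) => f (z i).1 * q (z i).2)
    Finset.univ fun i _ => memLp_two_weight_mul_vel_localGibbsLaw_const ha hθ hσ u Φ N hf hfC hq
      i).const_mul _

end

end Summit.AtomisticToContinuum.HydrodynamicLimit.Theorems.HemisphereAffineSlaving
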